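import Literature.MathematicalPhysics.QuantumFieldTheory.Balaban1983to89.B8Ineq159FlatMaps
import Literature.MathematicalPhysics.QuantumFieldTheory.Balaban1983to89.B7Prop5Flat
import Literature.MathematicalPhysics.QuantumFieldTheory.Balaban1983to89.B8Eq191FlatLettersCubeMember

/-!
# `Balaban1983to89.B8Ineq159FlatCornerDefect` — a LOCATED TYPING DEFECT of the tree's (1.59)-socket currency at FINITE Dirichlet
# regions: the scalar flat (1.59) clause «|v|₍₋₁₎ ≦ B₀(|J(v)|₍₋₃₎ + |B₁(v)|)» with the left side read on the PLAQUETTE COLLAR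
# (`SideTouches`) is FALSE on every region `Ω₀ ≠ ℤᵈ` with an exposed corner — kernel certificate by an explicit two-bond witness

statement-level skeleton of published theorems with citation tags; proofs where landed; nothing here is a claim about the
Yang–Mills mass gap

`[Balaban1985RegularSpaces]` ("B8", CMP **99** (1985) 75–102) (1.59) p. 86 and the norms after (1.55) p. 86 («|A|₍α₎ = sup_j sup_{Ω_j}
(Lʲη)^{−α}|A|» — a supremum over the bonds OF `Ω_j`), p. 77 (a bond ∕ plaquette belongs to `Ω` iff one of its end-points ∕ corners
does), Prop. 6 p. 99 and p. 77 («we admit the case where some domains Ω_j are equal to T_η»: the Prop.-6 family is `(T, □₁, …, □_k)`);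
[4] = `[Balaban1985BackgroundPropagators]` Thm 3.3 p. 399.  PDF held: `paper:balaban1985-cmp99-regular-spaces-gauge-fixing` (pp. 85–88 =
PDF 11–14 re-read this session on the text layer).

CITATION HEADER (lean-in-tree rule).  Cell `pub-ymgap` (YM Track A, HUMAN RULING D-0062), DAG node N05 = [B8], seat `pub-ymgap-dag-n05-e` (g5;
director-ym R141 (C), FAN-OUT §N05 row s3b).  WHAT IS CERTIFIED.  The two-member (1.59) clause of the N05 socket family — `B8LeafModelZd.SockH59`,
its instance `H59₁` displayed by `B8Prop6CubeMemberFlat3.prop6_exists_cubeMember_at₃` ∕ `B8Prop6CubeMemberFlatScalar.prop6_cubeMember_flat_of_real`,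
and the SCALAR clause of `B8Ineq159FlatOfScalar.flat159_clause_of_scalar` — bounds `msup L m η (−1) (SideTouches (Ω j)) v` over the sides of
ALL plaquettes touching `Ω_j`, while every term on the right reads `v` only near `Ω₀`: `J = D^{η*}_1D^η_1v` is read on the bonds
`BondTouches (Ω j)` (`bondNorm`), the averages `Q_j` on constraint bonds whose boxes lie in `Ω₀`, the Landau condition at the sites of
`Ω₀`.  At a FINITE `Ω₀` with a corner `c` maximal in two directions `i₁ ≠ i₂`, the far corner `z₀ = c + e_{i₁} + e_{i₂}` of the corner
plaquette `p₀` lies outside `Ω₀` and the two outer sides `s₁ = ⟨c + e_{i₁}, z₀⟩`, `s₂ = ⟨c + e_{i₂}, z₀⟩` of `p₀` are in the collar but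
touch nothing.  THE WITNESS `v := δ_{s₁} + δ_{s₂}` (the pure gauge `dδ_{z₀}` restricted to the collar): `curl_{p₀}v = v(s₁) − v(s₂) = 0`
and `p₀` is the ONLY plaquette through a bond near `Ω₀` having `s₁` or `s₂` as a side (§1: a unit plaquette with a corner `q ≤ c` in
the two directions and the corner `z₀` is `p₀`), so `J(v) = 0` on every bond touching any `Ω_j ⊂ Ω₀`; `Q_j(v) = 0` on the constraint
bonds (`B7Prop5Flat.linQIter_bump_eq_zero`); `v` is in the flat Landau gauge with multiplier `0`; hence the right side is `B₀·0`
while the left side is `≥ (L⁰η)·‖v(s₁)‖ = η > 0`.  ★ `scalar159_clause_false_of_corner` (generic domain data), ★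
`scalar159_clause_false_cubeMember` (the cube member `cubeFam false ∕ cubeLamS ∕ cubeLamB` of (1.131), every `k`, truncation `m ≤ k`,
`ρ ≥ 1`).  CONSEQUENCE (recorded, not re-typed here): the `𝔸`-valued `H59₁`∕`SockH59` reach the same mode through their free binder `u`
(a unitary bump at `z₀` passes `Restr129`, `mgauge`, the Landau condition and the exponent bounds), so the Prop.-6-at-`{□_j}` displays
with `cubeFam false` are vacuous at `U₀ = 1` as typed; PRINT IS CONSISTENT (its norms are suprema over the bonds of `Ω_j`, and its
Prop.-6 family has `Ω₀ = T`).  Repairs belong to the socket owner (LHS over `BondTouches`, or the family `cubeFam true`).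

HONEST SCOPE.  A negative typing certificate with an explicit witness; nothing of [4] is proved or refuted; count-neutral; N05 NOT
discharged; SECOND-GAP: none (re-typing); one finite `T⁴` programme at fixed `ε`, Bałaban as printed; nothing continuum ∕ ℝ⁴ ∕ OS ∕
mass-gap ∕ Clay.  No `sorry`, no `def`, no `instance`, no `notation`.  Unit `pub-ymgap-dag-n05-e` (g5), 2026-08-27.
-/

noncomputable section

namespace Literature.MathematicalPhysics.QuantumFieldTheory.Balaban1983to89.B8Ineq159FlatCornerDefect

open NormedSpace Finset
open Complex (I)
open B7Prop1Explicit (e e_apply boxVec)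
open B7Prop1Local (InBox loK bondHiK)
open B8Ineq132 (covDeriv covDerivFwd BondTouches PlaqTouches)
open B8Eq143PlaqExpansion (pdiv)
open B8Eq146AExpansion (plaqCovDeriv plaqCovDeriv_eq_covDerivFwd iEta)
open B8Eq155JBound (Jcur wsup wsup_le le_wsup wsup_nonneg)
open B8ScaledSupNorm (weight msup Bdd bondNorm msup_le msup_nonneg weight_mul_norm_le_msup weight_neg_natCast weight_pos
  weight_nonneg)
open B8Eq138LandauZd (covDivB covLap QT IsLandau138)
open B8Eq140Level (SideTouches IsSide)
open B7Prop4GeneralLevels (linCovIter)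
open B7Prop4Flat (linQIter norm_linQIter_le)
open B7Prop5Flat (bump bump_eq_zero_of norm_bump_le BondIn linQIter_add linQIter_bump_eq_zero)
open B9Eq316TowerFlatIsOneStep (linCovIter_one_left)
open B8Eq191FlatStencils (covDerivFwd_flat_apply covDeriv_flat_apply covLap_flat_apply QT_flat_apply)
open B8Eq131Cubes (sqLo sqHi bLo bHi gs one_le_gs cube)
open B8Eq131CubesAdmissible (cubeFam cubeFam_false_of_le)
open B8CubeMemberZd (cubeLamS cubeLamB hbox_cubeLamB)
open B8Eq191FlatLettersCubeMember (cubeFam_subset_zero)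
open B8Ineq130 (tlo thi tlo_zero thi_zero)

export B7Prop1Explicit (Site)

variable {d : ℕ}

/-! ## §1 Geometry of a unit plaquette at an exposed corner -/

/-- Coordinates of the corners of the plaquette `p_{κλ}(z)` (`κ ≠ λ`): every corner `q` has `z_i ≤ q_i ≤ z_i + 1`, and `q_i = z_i`
in the directions `i ∉ {κ, λ}`. [folklore] [cite: Balaban1985RegularSpaces, p.77 (plaquette convention)] -/
theorem corner_coord (z q : Site d) {κ ν : Fin d} (hκν : κ ≠ ν)
    (hq : q = z ∨ q = z + e κ ∨ q = z + e ν ∨ q = z + e κ + e ν) (i : Fin d) :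
    z i ≤ q i ∧ q i ≤ z i + 1 ∧ (i ≠ κ → i ≠ ν → q i = z i) := by
  rcases hq with rfl | rfl | rfl | rfl
  · exact ⟨le_rfl, by omega, fun _ _ => rfl⟩
  · simp only [Pi.add_apply, e_apply]
    split_ifs with h
    · exact ⟨by omega, by omega, fun h' _ => absurd h h'⟩
    · exact ⟨by omega, by omega, fun _ _ => by ring⟩
  · simp only [Pi.add_apply, e_apply]
    split_ifs with h
    · exact ⟨by omega, by omega, fun _ h' => absurd h h'⟩
    · exact ⟨by omega, by omega, fun _ _ => by ring⟩
  · simp only [Pi.add_apply, e_apply]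
    split_ifs with h h' h'
    · exact absurd (h.symm.trans h') hκν
    · exact ⟨by omega, by omega, fun h'' _ => absurd h h''⟩
    · exact ⟨by omega, by omega, fun _ h'' => absurd h' h''⟩
    · exact ⟨by omega, by omega, fun _ _ => by ring⟩

/-- **THE CORNER LEMMA.**  If the plaquette `p_{κλ}(z)` has a corner `q` with `q_{i₁} ≤ c_{i₁}`, `q_{i₂} ≤ c_{i₂}` (`i₁ ≠ i₂`) and the
corner `z₀ = c + e_{i₁} + e_{i₂}`, then it is the corner plaquette: `z = c` and `{κ, λ} = {i₁, i₂}`. [folklore]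
[cite: Balaban1985RegularSpaces, p.77 (plaquette convention)] -/
theorem corner_key {i₁ i₂ : Fin d} (hne : i₁ ≠ i₂) (c z q : Site d) {κ ν : Fin d} (hκν : κ ≠ ν)
    (hq : q = z ∨ q = z + e κ ∨ q = z + e ν ∨ q = z + e κ + e ν) (hq1 : q i₁ ≤ c i₁) (hq2 : q i₂ ≤ c i₂)
    (hz : c + e i₁ + e i₂ = z ∨ c + e i₁ + e i₂ = z + e κ ∨ c + e i₁ + e i₂ = z + e ν ∨ c + e i₁ + e i₂ = z + e κ + e ν) :
    z = c ∧ ((κ = i₁ ∧ ν = i₂) ∨ (κ = i₂ ∧ ν = i₁)) := by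
  have CBq := corner_coord z q hκν hq
  have CBz := corner_coord z (c + e i₁ + e i₂) hκν hz
  have hz1 : (c + e i₁ + e i₂) i₁ = c i₁ + 1 := by simp [e_apply, hne]
  have hz2 : (c + e i₁ + e i₂) i₂ = c i₂ + 1 := by simp [e_apply, hne.symm]
  obtain ⟨l1, -, -⟩ := CBq i₁
  obtain ⟨l2, -, -⟩ := CBq i₂
  obtain ⟨-, u1, f1⟩ := CBz i₁
  obtain ⟨-, u2, f2⟩ := CBz i₂
  rw [hz1] at u1 f1
  rw [hz2] at u2 f2
  have e1 : z i₁ = c i₁ := by omega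
  have e2 : z i₂ = c i₂ := by omega
  -- the directions `i₁`, `i₂` are among `κ, ν`
  have hi1 : i₁ = κ ∨ i₁ = ν := by
    by_contra h
    simp only [not_or] at h
    have := f1 h.1 h.2
    omega
  have hi2 : i₂ = κ ∨ i₂ = ν := by
    by_contra h
    simp only [not_or] at h
    have := f2 h.1 h.2
    omega
  have hdir : (κ = i₁ ∧ ν = i₂) ∨ (κ = i₂ ∧ ν = i₁) := by
    rcases hi1 with h1 | h1 <;> rcases hi2 with h2 | h2
    · exact absurd (h1.trans h2.symm) hne
    · exact Or.inl ⟨h1.symm, h2.symm⟩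
    · exact Or.inr ⟨h2.symm, h1.symm⟩
    · exact absurd (h1.trans h2.symm) hne
  refine ⟨?_, hdir⟩
  funext i
  by_cases hi₁ : i = i₁
  · rw [hi₁]; exact e1
  by_cases hi₂ : i = i₂
  · rw [hi₂]; exact e2
  have hκ : i ≠ κ := by rcases hdir with ⟨h, -⟩ | ⟨h, -⟩ <;> (rw [h]; assumption)
  have hν : i ≠ ν := by rcases hdir with ⟨-, h⟩ | ⟨-, h⟩ <;> (rw [h]; assumption)
  obtain ⟨-, -, f⟩ := CBz i
  have hzi : (c + e i₁ + e i₂) i = c i := by simp [e_apply, hi₁, hi₂]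
  rw [← hzi, f hκ hν]

/-! ## §2 The witness `v = δ_{s₁} + δ_{s₂}` on the outer sides of the corner plaquette -/

section Witness

variable {𝔸 : Type*} [NormedRing 𝔸] [NormedAlgebra ℂ 𝔸]

omit [NormedAlgebra ℂ 𝔸] in
/-- The witness vanishes off its two bonds `s₁ = ⟨c + e_{i₁}, ·+e_{i₂}⟩`, `s₂ = ⟨c + e_{i₂}, ·+e_{i₁}⟩` (support bookkeeping of the certificate).
[cite: Balaban1985RegularSpaces, p.77 (bond convention), (1.59) p.86] -/
theorem wit_eq_zero_of (c : Site d) (i₁ i₂ : Fin d) (X : 𝔸) {w : Site d} {δ : Fin d}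
    (h : ¬ ((w = c + e i₁ ∧ δ = i₂) ∨ (w = c + e i₂ ∧ δ = i₁))) :
    (bump (c + e i₁) i₂ X + bump (c + e i₂) i₁ X) w δ = 0 := by
  simp only [not_or] at h
  rw [Pi.add_apply, Pi.add_apply, bump_eq_zero_of X h.1, bump_eq_zero_of X h.2, add_zero]

omit [NormedAlgebra ℂ 𝔸] in
/-- The witness is bounded by `‖X‖ + ‖X‖` bondwise (boundedness side condition of the p. 86 suprema).
[cite: Balaban1985RegularSpaces, p.86 (definition after (1.55))] -/
theorem norm_wit_le (c : Site d) (i₁ i₂ : Fin d) (X : 𝔸) (w : Site d) (δ : Fin d) :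
    ‖(bump (c + e i₁) i₂ X + bump (c + e i₂) i₁ X) w δ‖ ≤ ‖X‖ + ‖X‖ := by
  rw [Pi.add_apply, Pi.add_apply]
  exact (norm_add_le _ _).trans (add_le_add (norm_bump_le _ _ _ _ _) (norm_bump_le _ _ _ _ _))

omit [NormedAlgebra ℂ 𝔸] in
/-- The value of the witness on `s₁` is `X` (`i₁ ≠ i₂`). [cite: Balaban1985RegularSpaces, p.77 (bond convention), (1.59) p.86] -/
theorem wit_apply_s₁ {i₁ i₂ : Fin d} (hne : i₁ ≠ i₂) (c : Site d) (X : 𝔸) :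
    (bump (c + e i₁) i₂ X + bump (c + e i₂) i₁ X) (c + e i₁) i₂ = X := by
  have h2 : ¬ (c + e i₁ = c + e i₂ ∧ i₂ = i₁) := fun h => hne h.2.symm
  rw [Pi.add_apply, Pi.add_apply, bump_eq_zero_of X h2, add_zero]
  simp [bump]

omit [NormedAlgebra ℂ 𝔸] in
/-- The value of the witness on `s₂` is `X` (`i₁ ≠ i₂`). [cite: Balaban1985RegularSpaces, p.77 (bond convention), (1.59) p.86] -/
theorem wit_apply_s₂ {i₁ i₂ : Fin d} (hne : i₁ ≠ i₂) (c : Site d) (X : 𝔸) :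
    (bump (c + e i₁) i₂ X + bump (c + e i₂) i₁ X) (c + e i₂) i₁ = X := by
  have h1 : ¬ (c + e i₂ = c + e i₁ ∧ i₁ = i₂) := fun h => hne h.2
  rw [Pi.add_apply, Pi.add_apply, bump_eq_zero_of X h1, zero_add]
  simp [bump]

omit [NormedAlgebra ℂ 𝔸] in
/-- The witness vanishes on the two sides of the corner plaquette at `c`. [cite: Balaban1985RegularSpaces, p.77 (plaquette convention), (1.59) p.86] -/
theorem wit_apply_corner {i₁ i₂ : Fin d} (c : Site d) (X : 𝔸) (δ : Fin d) :
    (bump (c + e i₁) i₂ X + bump (c + e i₂) i₁ X) c δ = 0 := by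
  refine wit_eq_zero_of c i₁ i₂ X ?_
  rintro (⟨h, -⟩ | ⟨h, -⟩)
  · have := congrFun h i₁; simp [e_apply] at this
  · have := congrFun h i₂; simp [e_apply] at this

/-- A bond of the witness's support, read near the region: if a side `(w, δ)` of the plaquette `p_{κλ}(z)` carries the witness and
the plaquette has a corner `q` with `q_{i₁} ≤ c_{i₁}`, `q_{i₂} ≤ c_{i₂}`, then the plaquette is the corner plaquette.
[cite: Balaban1985RegularSpaces, p.77 (plaquette convention)] -/
theorem corner_of_side {i₁ i₂ : Fin d} (hne : i₁ ≠ i₂) (c z q : Site d) {κ ν : Fin d} (hκν : κ ≠ ν)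
    (hq : q = z ∨ q = z + e κ ∨ q = z + e ν ∨ q = z + e κ + e ν) (hq1 : q i₁ ≤ c i₁) (hq2 : q i₂ ≤ c i₂)
    {w : Site d} {δ : Fin d} (hside : (w = z + e κ ∧ δ = ν) ∨ (w = z ∧ δ = ν) ∨ (w = z + e ν ∧ δ = κ) ∨ (w = z ∧ δ = κ))
    (hsupp : (w = c + e i₁ ∧ δ = i₂) ∨ (w = c + e i₂ ∧ δ = i₁)) :
    z = c ∧ ((κ = i₁ ∧ ν = i₂) ∨ (κ = i₂ ∧ ν = i₁)) := by
  -- the far end-point `w + e δ` of the side is the corner `z₀ = c + e i₁ + e i₂`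
  have hz0 : c + e i₁ + e i₂ = w + e δ := by
    rcases hsupp with ⟨hw, hδ⟩ | ⟨hw, hδ⟩
    · rw [hw, hδ]
    · rw [hw, hδ, add_assoc, add_comm (e i₁), ← add_assoc]
  refine corner_key hne c z q hκν hq hq1 hq2 ?_
  rcases hside with ⟨hw, hδ⟩ | ⟨hw, hδ⟩ | ⟨hw, hδ⟩ | ⟨hw, hδ⟩ <;> rw [hw, hδ] at hz0
  · exact Or.inr (Or.inr (Or.inr hz0))
  · exact Or.inr (Or.inr (Or.inl hz0))
  · refine Or.inr (Or.inr (Or.inr ?_)); rw [hz0, add_assoc, add_comm (e ν), ← add_assoc]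
  · exact Or.inr (Or.inl hz0)

/-- **The plaquette derivative of the witness vanishes on every plaquette with a corner in the quadrant `{q : q_{i₁} ≤ c_{i₁}, q_{i₂} ≤
c_{i₂}}`** — the corner plaquette by cancellation (`v(s₁) − v(s₂) = 0`), every other one because none of its sides carries the witness.
[cite: Balaban1985BackgroundPropagators, (3.4) p.391; Balaban1985RegularSpaces, (1.55) p.86] -/
theorem plaqCovDeriv_wit_eq_zero {i₁ i₂ : Fin d} (hne : i₁ ≠ i₂) (η : ℝ) (c z q : Site d) {κ ν : Fin d} (hκν : κ ≠ ν)
    (hq : q = z ∨ q = z + e κ ∨ q = z + e ν ∨ q = z + e κ + e ν) (hq1 : q i₁ ≤ c i₁) (hq2 : q i₂ ≤ c i₂) (X : 𝔸) :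
    plaqCovDeriv η (1 : Site d → Fin d → 𝔸ˣ) (bump (c + e i₁) i₂ X + bump (c + e i₂) i₁ X) κ ν z = 0 := by
  rw [plaqCovDeriv_eq_covDerivFwd, covDerivFwd_flat_apply, covDerivFwd_flat_apply]
  by_cases hA : z = c ∧ ((κ = i₁ ∧ ν = i₂) ∨ (κ = i₂ ∧ ν = i₁))
  · -- the corner plaquette: `v(c + e i₁, i₂) = X = v(c + e i₂, i₁)`, `v(c, ·) = 0`
    obtain ⟨hzc, hdir⟩ := hA
    rw [hzc]
    rcases hdir with ⟨hκ, hν⟩ | ⟨hκ, hν⟩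
    · rw [hκ, hν, wit_apply_s₁ hne c X, wit_apply_s₂ hne c X, wit_apply_corner c X i₂, wit_apply_corner c X i₁, sub_self]
    · rw [hκ, hν, wit_apply_s₁ hne c X, wit_apply_s₂ hne c X, wit_apply_corner c X i₂, wit_apply_corner c X i₁, sub_self]
  · -- any other plaquette: no side carries the witness
    have hzero : ∀ (w : Site d) (δ : Fin d),
        ((w = z + e κ ∧ δ = ν) ∨ (w = z ∧ δ = ν) ∨ (w = z + e ν ∧ δ = κ) ∨ (w = z ∧ δ = κ)) →
        (bump (c + e i₁) i₂ X + bump (c + e i₂) i₁ X) w δ = 0 := by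
      intro w δ hside
      refine wit_eq_zero_of c i₁ i₂ X fun hsupp => hA ?_
      exact corner_of_side hne c z q hκν hq hq1 hq2 hside hsupp
    rw [hzero _ _ (Or.inl ⟨rfl, rfl⟩), hzero _ _ (Or.inr (Or.inl ⟨rfl, rfl⟩)),
      hzero _ _ (Or.inr (Or.inr (Or.inl ⟨rfl, rfl⟩))), hzero _ _ (Or.inr (Or.inr (Or.inr ⟨rfl, rfl⟩)))]
    simp

/-- **The current of the witness vanishes on every bond with an end-point in the quadrant** (in particular on every bond touching a
region `Ω₀ ⊂ {q : q_{i₁} ≤ c_{i₁}, q_{i₂} ≤ c_{i₂}}`): each plaquette through such a bond has that end-point as a corner.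
[cite: Balaban1985RegularSpaces, (1.55) p.86, (1.2) p.76] -/
theorem Jcur_wit_eq_zero {i₁ i₂ : Fin d} (hne : i₁ ≠ i₂) (η : ℝ) (c : Site d) (X : 𝔸) {x : Site d} {μ : Fin d}
    (hx : (x i₁ ≤ c i₁ ∧ x i₂ ≤ c i₂) ∨ ((x + e μ) i₁ ≤ c i₁ ∧ (x + e μ) i₂ ≤ c i₂)) :
    Jcur η (1 : Site d → Fin d → 𝔸ˣ) (bump (c + e i₁) i₂ X + bump (c + e i₂) i₁ X) μ x = 0 := by
  -- every plaquette derivative entering `J_μ(x)` vanishes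
  have hP : ∀ ν, ν ≠ μ → ∀ z, (z = x ∨ z = x - e ν) →
      plaqCovDeriv η (1 : Site d → Fin d → 𝔸ˣ) (bump (c + e i₁) i₂ X + bump (c + e i₂) i₁ X) ν μ z = 0 ∧
      plaqCovDeriv η (1 : Site d → Fin d → 𝔸ˣ) (bump (c + e i₁) i₂ X + bump (c + e i₂) i₁ X) μ ν z = 0 := by
    intro ν hνμ z hz
    -- the corners `x` and `x + e μ` of the plaquette, in the two shapes
    rcases hx with ⟨h1, h2⟩ | ⟨h1, h2⟩ <;> rcases hz with hz | hz <;> rw [hz]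
    · exact ⟨plaqCovDeriv_wit_eq_zero hne η c x x hνμ (Or.inl rfl) h1 h2 X,
        plaqCovDeriv_wit_eq_zero hne η c x x hνμ.symm (Or.inl rfl) h1 h2 X⟩
    · have hc : x = x - e ν + e ν := by rw [sub_add_cancel]
      exact ⟨plaqCovDeriv_wit_eq_zero hne η c (x - e ν) x hνμ (Or.inr (Or.inl hc)) h1 h2 X,
        plaqCovDeriv_wit_eq_zero hne η c (x - e ν) x hνμ.symm (Or.inr (Or.inr (Or.inl hc))) h1 h2 X⟩
    · exact ⟨plaqCovDeriv_wit_eq_zero hne η c x (x + e μ) hνμ (Or.inr (Or.inr (Or.inl rfl))) h1 h2 X,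
        plaqCovDeriv_wit_eq_zero hne η c x (x + e μ) hνμ.symm (Or.inr (Or.inl rfl)) h1 h2 X⟩
    · have hc : x + e μ = x - e ν + e ν + e μ := by rw [sub_add_cancel]
      have hc' : x + e μ = x - e ν + e μ + e ν := by rw [hc, add_assoc, add_comm (e ν), ← add_assoc]
      exact ⟨plaqCovDeriv_wit_eq_zero hne η c (x - e ν) (x + e μ) hνμ (Or.inr (Or.inr (Or.inr hc))) h1 h2 X,
        plaqCovDeriv_wit_eq_zero hne η c (x - e ν) (x + e μ) hνμ.symm (Or.inr (Or.inr (Or.inr hc'))) h1 h2 X⟩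
  unfold Jcur pdiv
  have h1 : ∀ ν ∈ Finset.Iio μ, covDeriv η (1 : Site d → Fin d → 𝔸ˣ) ν
      (plaqCovDeriv η (1 : Site d → Fin d → 𝔸ˣ) (bump (c + e i₁) i₂ X + bump (c + e i₂) i₁ X) ν μ) x = 0 := by
    intro ν hν
    have hνμ : ν ≠ μ := (Finset.mem_Iio.mp hν).ne
    rw [covDeriv_flat_apply, (hP ν hνμ _ (Or.inr rfl)).1, (hP ν hνμ _ (Or.inl rfl)).1, sub_self, smul_zero]
  have h2 : ∀ ν ∈ Finset.Ioi μ, covDeriv η (1 : Site d → Fin d → 𝔸ˣ) ν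
      (plaqCovDeriv η (1 : Site d → Fin d → 𝔸ˣ) (bump (c + e i₁) i₂ X + bump (c + e i₂) i₁ X) μ ν) x = 0 := by
    intro ν hν
    have hνμ : ν ≠ μ := (Finset.mem_Ioi.mp hν).ne'
    rw [covDeriv_flat_apply, (hP ν hνμ _ (Or.inr rfl)).2, (hP ν hνμ _ (Or.inl rfl)).2, sub_self, smul_zero]
  rw [Finset.sum_eq_zero h1, Finset.sum_eq_zero h2, sub_self]

/-- **The flat divergence of the witness vanishes at every site of the quadrant** (so the witness is in the flat Landau gauge of any
`Ω₀` inside it, with multiplier `0`). [cite: Balaban1985RegularSpaces, (1.38) p.82] -/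
theorem covDivB_wit_eq_zero {i₁ i₂ : Fin d} (hne : i₁ ≠ i₂) (η : ℝ) (c : Site d) (X : 𝔸) {x : Site d}
    (hx : x i₁ ≤ c i₁ ∧ x i₂ ≤ c i₂) :
    covDivB η (1 : Site d → Fin d → 𝔸ˣ) (bump (c + e i₁) i₂ X + bump (c + e i₂) i₁ X) x = 0 := by
  unfold covDivB
  refine Finset.sum_eq_zero fun μ _ => ?_
  have hz1 : (c + e i₁) i₁ = c i₁ + 1 := by simp [e_apply]
  have hz2 : (c + e i₂) i₂ = c i₂ + 1 := by simp [e_apply]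
  have hA : ¬ ((x = c + e i₁ ∧ μ = i₂) ∨ (x = c + e i₂ ∧ μ = i₁)) := by
    rintro (⟨h, -⟩ | ⟨h, -⟩)
    · have := congrFun h i₁; rw [hz1] at this; omega
    · have := congrFun h i₂; rw [hz2] at this; omega
  have hB : ¬ ((x - e μ = c + e i₁ ∧ μ = i₂) ∨ (x - e μ = c + e i₂ ∧ μ = i₁)) := by
    rintro (⟨h, rfl⟩ | ⟨h, rfl⟩)
    · have := congrFun h i₁
      simp only [Pi.sub_apply, e_apply, if_neg hne] at this
      rw [hz1] at this; omega
    · have := congrFun h i₂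
      simp only [Pi.sub_apply, e_apply, if_neg hne.symm] at this
      rw [hz2] at this; omega
  rw [covDeriv_flat_apply, wit_eq_zero_of c i₁ i₂ X hB, wit_eq_zero_of c i₁ i₂ X hA, sub_self, smul_zero]

end Witness

/-! ## §3 ★ The scalar flat (1.59) clause is false at every finite region with an exposed corner -/

section Defect

/-- ★ **THE SCALAR FLAT (1.59) CLAUSE IN THE `SideTouches` CURRENCY IS FALSE AT EVERY REGION WITH AN EXPOSED CORNER.**  DATA: directions
`i₁ ≠ i₂`, `L ≥ 1`, `η > 0`, a truncation level `m`, domain data `Ω, Λs, Λb`, ANY constant `B₀`, and a site `c` with (i) `c ∈ Ω 0`,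
(ii) `Ω 0 ⊂ {x : x_{i₁} ≤ c_{i₁}, x_{i₂} ≤ c_{i₂}}` (an exposed corner — every finite box has one), (iii) `Ω j ⊂ Ω 0` for `j ≤ m`, (iv) the
boxes of the constraint bonds `Λb j` lie in `Ω 0` (the cube member's `hbox`).  CONCLUSION: the clause «for every ℂ-valued `v` in the flat
Landau gauge `IsLandau138 L m η (Ω 0) Λs 1 v` vanishing off the plaquette collars, `msup(−1) v ≤ B₀(bondNorm(−3)(J v) + wsup 1 (Q(iηv)
on Λb))` and the gradient member» — the hypothesis `SCALAR` of `B8Ineq159FlatOfScalar.flat159_clause_of_scalar`, the `ℂ`-instance of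
the body of `B8LeafModelZd.SockH59`∕`H59₁` after their `u, W`-binders — is FALSE.  WITNESS: `v = δ_{s₁} + δ_{s₂}` on the outer sides of
the corner plaquette (§2): Landau with multiplier `0` (`covDivB_wit_eq_zero`), `J(v) = 0` on all bonds touching `Ω 0`
(`Jcur_wit_eq_zero`), `Q_j(iηv) = 0` on `Λb` (`B7Prop5Flat.linQIter_bump_eq_zero`), so the right side is `0`, while the left side is
`≥ (L⁰η)·‖v(s₁)‖ = η`. [cite: Balaban1985RegularSpaces, (1.59) p.86, p.86 (norms «sup over Ω_j»), p.77 (bond convention); Balaban1985BackgroundPropagators, Thm 3.3 p.399] -/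
theorem scalar159_clause_false_of_corner {i₁ i₂ : Fin d} (hne : i₁ ≠ i₂) {L : ℕ} (hL : 1 ≤ L) {η : ℝ} (hη : 0 < η) (m : ℕ)
    (Ω : ℕ → Set (Site d)) (Λs : ℕ → Set (Site d)) (Λb : ℕ → Set (Site d × Fin d)) (B₀ : ℝ) (c : Site d) (hc : c ∈ Ω 0)
    (hmax : ∀ x ∈ Ω 0, x i₁ ≤ c i₁ ∧ x i₂ ≤ c i₂) (hΩ0 : ∀ j, j ≤ m → Ω j ⊆ Ω 0)
    (hbox : ∀ j, j ≤ m → ∀ q ∈ Λb j, ∀ x, InBox (loK L j q.1) (bondHiK L j q.1 q.2) x → x ∈ Ω 0) :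
    ¬ (∀ v : Site d → Fin d → ℂ,
      IsLandau138 L m η (Ω 0) Λs (1 : Site d → Fin d → ℂˣ) v →
      (∀ (y : Site d) (τ : Fin d), (∀ j, j ≤ m → ¬ SideTouches (Ω j) y τ) → v y τ = 0) →
      msup L m η (-(1 : ℝ)) (fun j (b : Site d × Fin d) => SideTouches (Ω j) b.1 b.2) (fun b => v b.1 b.2)
          ≤ B₀ * (bondNorm L m η (-(3 : ℝ)) Ω (fun x μ => Jcur η (1 : Site d → Fin d → ℂˣ) v μ x)
            + wsup 1 (fun p : {p : ℕ × (Site d × Fin d) // p.1 ≤ m ∧ p.2 ∈ Λb p.1} =>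
                linCovIter L (1 : Site d → Fin d → ℂˣ) (iEta η v) p.1.1 p.1.2.1 p.1.2.2)) ∧
        msup L m η (-(2 : ℝ)) (fun j (t : Fin d × Fin d × Site d) => SideTouches (Ω j) t.2.2 t.2.1)
            (fun t => covDerivFwd η (1 : Site d → Fin d → ℂˣ) t.1 (fun z => v z t.2.1) t.2.2)
          ≤ B₀ * (bondNorm L m η (-(3 : ℝ)) Ω (fun x μ => Jcur η (1 : Site d → Fin d → ℂˣ) v μ x)
            + wsup 1 (fun p : {p : ℕ × (Site d × Fin d) // p.1 ≤ m ∧ p.2 ∈ Λb p.1} =>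
                linCovIter L (1 : Site d → Fin d → ℂˣ) (iEta η v) p.1.1 p.1.2.1 p.1.2.2))) := by
  intro H
  -- the witness
  obtain ⟨v, hv⟩ : ∃ v : Site d → Fin d → ℂ, v = bump (c + e i₁) i₂ (1 : ℂ) + bump (c + e i₂) i₁ 1 := ⟨_, rfl⟩
  have hL1 : (1 : ℝ) ≤ L := by exact_mod_cast hL
  have hz1 : (c + e i₁) i₁ = c i₁ + 1 := by simp [e_apply]
  have hz2 : (c + e i₂) i₂ = c i₂ + 1 := by simp [e_apply]
  have hout1 : c + e i₁ ∉ Ω 0 := fun h => by have := (hmax _ h).1; rw [hz1] at this; omega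
  have hout2 : c + e i₂ ∉ Ω 0 := fun h => by have := (hmax _ h).2; rw [hz2] at this; omega
  -- (a) the witness is in the flat Landau gauge of `Ω 0`, multiplier `0`
  have hLan : IsLandau138 L m η (Ω 0) Λs (1 : Site d → Fin d → ℂˣ) v := by
    refine ⟨fun _ _ => 0, fun x hx => ?_⟩
    have hind : (Ω 0).indicator (covDivB η (1 : Site d → Fin d → ℂˣ) v) = fun _ => 0 := by
      funext y
      by_cases hy : y ∈ Ω 0
      · rw [Set.indicator_of_mem hy, hv]; exact covDivB_wit_eq_zero hne η c 1 (hmax y hy)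
      · exact Set.indicator_of_notMem hy _
    rw [hind, covLap_flat_apply, QT_flat_apply]
    simp
  -- (b) the witness vanishes off the collar of `Ω 0` (its two bonds are sides of the corner plaquette)
  have hside1 : SideTouches (Ω 0) (c + e i₁) i₂ := ⟨c, i₁, i₂, hne, Or.inl hc, Or.inr (Or.inl ⟨rfl, rfl⟩)⟩
  have hside2 : SideTouches (Ω 0) (c + e i₂) i₁ := ⟨c, i₁, i₂, hne, Or.inl hc, Or.inr (Or.inr (Or.inl ⟨rfl, rfl⟩))⟩
  have hsupp : ∀ (y : Site d) (τ : Fin d), (∀ j, j ≤ m → ¬ SideTouches (Ω j) y τ) → v y τ = 0 := by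
    intro y τ h
    rw [hv]
    refine wit_eq_zero_of c i₁ i₂ 1 ?_
    rintro (⟨rfl, rfl⟩ | ⟨rfl, rfl⟩)
    · exact h 0 (Nat.zero_le _) hside1
    · exact h 0 (Nat.zero_le _) hside2
  obtain ⟨h1, -⟩ := H v hLan hsupp
  -- (c) the right side vanishes: `J(v) = 0` on the bonds touching any `Ω j`, `Q_j(iηv) = 0` on `Λb`
  have hJ : bondNorm L m η (-(3 : ℝ)) Ω (fun x μ => Jcur η (1 : Site d → Fin d → ℂˣ) v μ x) = 0 := by
    refine le_antisymm (msup_le le_rfl fun j hj b hb => ?_) (msup_nonneg L m hη.le _ _ _)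
    have hb0 : BondTouches (Ω 0) b.1 b.2 := by
      rcases hb with h | h
      · exact Or.inl (hΩ0 j hj h)
      · exact Or.inr (hΩ0 j hj h)
    have hq : (b.1 i₁ ≤ c i₁ ∧ b.1 i₂ ≤ c i₂) ∨ ((b.1 + e b.2) i₁ ≤ c i₁ ∧ (b.1 + e b.2) i₂ ≤ c i₂) := by
      rcases hb0 with h | h
      · exact Or.inl (hmax _ h)
      · exact Or.inr (hmax _ h)
    have hz : Jcur η (1 : Site d → Fin d → ℂˣ) v b.2 b.1 = 0 := by rw [hv]; exact Jcur_wit_eq_zero hne η c 1 hq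
    simp only [hz, norm_zero, mul_zero, le_refl]
  have hiEta : iEta η v = bump (c + e i₁) i₂ ((I : ℂ) * η) + bump (c + e i₂) i₁ ((I : ℂ) * η) := by
    funext y τ
    rw [hv]
    simp only [iEta, Pi.add_apply, bump]
    split_ifs <;> simp
    ring
  have hvbd : ∀ (y : Site d) (τ : Fin d), ‖iEta η v y τ‖ ≤ ‖(I : ℂ) * η‖ + ‖(I : ℂ) * η‖ := fun y τ => by
    rw [hiEta]; exact norm_wit_le c i₁ i₂ _ y τ
  have hQ : wsup 1 (fun p : {p : ℕ × (Site d × Fin d) // p.1 ≤ m ∧ p.2 ∈ Λb p.1} =>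
      linCovIter L (1 : Site d → Fin d → ℂˣ) (iEta η v) p.1.1 p.1.2.1 p.1.2.2) = 0 := by
    refine le_antisymm (wsup_le (fun p => ?_) le_rfl) (wsup_nonneg zero_le_one _)
    have hB : ∀ (y : Site d) (τ : Fin d), (y = c + e i₁ ∨ y = c + e i₂) →
        ¬ BondIn (loK L p.1.1 p.1.2.1) (bondHiK L p.1.1 p.1.2.1 p.1.2.2) y τ := by
      rintro y τ (rfl | rfl) ⟨hin, -⟩
      · exact hout1 (hbox p.1.1 p.2.1 p.1.2 p.2.2 _ hin)
      · exact hout2 (hbox p.1.1 p.2.1 p.1.2 p.2.2 _ hin)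
    rw [linCovIter_one_left L hL _ (by positivity) hvbd p.1.1, hiEta, linQIter_add,
      linQIter_bump_eq_zero L _ _ _ _ _ _ (hB _ _ (Or.inl rfl)), linQIter_bump_eq_zero L _ _ _ _ _ _ (hB _ _ (Or.inr rfl)),
      add_zero, norm_zero, mul_zero]
  rw [hJ, hQ, add_zero, mul_zero] at h1
  -- (d) the left side is at least `η`
  have hBdd : Bdd L m η (-(1 : ℝ)) (fun j (b : Site d × Fin d) => SideTouches (Ω j) b.1 b.2) (fun b => v b.1 b.2) := by
    refine ⟨(L : ℝ) ^ m * η * (‖(1 : ℂ)‖ + ‖(1 : ℂ)‖), fun j hj b _ => ?_⟩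
    have hw : weight L η (-(1 : ℝ)) j = (L : ℝ) ^ j * η := by simpa using weight_neg_natCast L η 1 j
    rw [hw]
    have hvb : ‖v b.1 b.2‖ ≤ ‖(1 : ℂ)‖ + ‖(1 : ℂ)‖ := by rw [hv]; exact norm_wit_le c i₁ i₂ 1 b.1 b.2
    exact mul_le_mul (mul_le_mul_of_nonneg_right (pow_le_pow_right₀ hL1 hj) hη.le) hvb (norm_nonneg _) (by positivity)
  have hlow := weight_mul_norm_le_msup hBdd (Nat.zero_le m) (i := (c + e i₁, i₂)) hside1
  have hw0 : weight L η (-(1 : ℝ)) 0 = η := by simpa using weight_neg_natCast L η 1 0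
  have hval : ‖v (c + e i₁) i₂‖ = 1 := by rw [hv, wit_apply_s₁ hne c (1 : ℂ), norm_one]
  rw [hw0, hval, mul_one] at hlow
  linarith

/-- ★ **THE SCALAR FLAT (1.59) CLAUSE IS FALSE AT THE CONCRETE CUBE MEMBER `{□_j}` OF (1.131)** (`Ω := cubeFam false L a M ρ k`, towers
`cubeLamS … m`, constraint bonds `cubeLamB … m`; `d ≥ 2`, `1 ≤ L ≤ ρ`, `η > 0`, any `M, k`, truncation `m ≤ k`, ANY `B₀`): the
hypothesis `SC59` that a Proposition-6-at-`{□_j}` display in the `SideTouches` currency would carry (and the `ℂ`-instance of the body of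
`H59₁` ∕ `SockH59` at this member) is unsatisfiable — the finite cube `□₀` has the exposed corner `hi = sqHi L a M ρ k 0`.
[cite: Balaban1985RegularSpaces, (1.59) p.86, (1.131) p.99, Prop. 6 p.99, p.77] -/
theorem scalar159_clause_false_cubeMember (hd2 : 2 ≤ d) {L : ℕ} (hL : 1 ≤ L) {η : ℝ} (hη : 0 < η) (a : Site d) (M : ℕ) {ρ : ℕ}
    (hρ : L ≤ ρ) (k : ℕ) {m : ℕ} (hm : m ≤ k) (B₀ : ℝ) :
    ¬ (∀ v : Site d → Fin d → ℂ,
      IsLandau138 L m η ((cubeFam false L a M ρ k) 0) ((cubeLamS L a M ρ k) m) (1 : Site d → Fin d → ℂˣ) v →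
      (∀ (y : Site d) (τ : Fin d), (∀ j, j ≤ m → ¬ SideTouches ((cubeFam false L a M ρ k) j) y τ) → v y τ = 0) →
      msup L m η (-(1 : ℝ)) (fun j (b : Site d × Fin d) => SideTouches ((cubeFam false L a M ρ k) j) b.1 b.2) (fun b => v b.1 b.2)
        ≤ B₀ * (bondNorm L m η (-(3 : ℝ)) (cubeFam false L a M ρ k) (fun x μ => Jcur η (1 : Site d → Fin d → ℂˣ) v μ x)
        + wsup 1 (fun p : {p : ℕ × (Site d × Fin d) // p.1 ≤ m ∧ p.2 ∈ (cubeLamB L a M ρ k) m p.1} =>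
        linCovIter L (1 : Site d → Fin d → ℂˣ) (iEta η v) p.1.1 p.1.2.1 p.1.2.2)) ∧
        msup L m η (-(2 : ℝ)) (fun j (t : Fin d × Fin d × Site d) => SideTouches ((cubeFam false L a M ρ k) j) t.2.2 t.2.1)
        (fun t => covDerivFwd η (1 : Site d → Fin d → ℂˣ) t.1 (fun z => v z t.2.1) t.2.2)
        ≤ B₀ * (bondNorm L m η (-(3 : ℝ)) (cubeFam false L a M ρ k) (fun x μ => Jcur η (1 : Site d → Fin d → ℂˣ) v μ x)
        + wsup 1 (fun p : {p : ℕ × (Site d × Fin d) // p.1 ≤ m ∧ p.2 ∈ (cubeLamB L a M ρ k) m p.1} =>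
        linCovIter L (1 : Site d → Fin d → ℂˣ) (iEta η v) p.1.1 p.1.2.1 p.1.2.2))) := by
  -- two directions
  obtain ⟨i₁, hi₁⟩ : ∃ i₁ : Fin d, i₁ = ⟨0, by omega⟩ := ⟨_, rfl⟩
  obtain ⟨i₂, hi₂⟩ : ∃ i₂ : Fin d, i₂ = ⟨1, by omega⟩ := ⟨_, rfl⟩
  have hne : i₁ ≠ i₂ := by rw [hi₁, hi₂]; exact fun h => absurd (Fin.mk.inj_iff.mp h) (by norm_num)
  -- `□₀` is the box `[lo, hi]`; its corner `hi` is exposed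
  have hΩ0 : (cubeFam false L a M ρ k) 0 = {x | InBox (sqLo L a ρ k 0) (sqHi L a M ρ k 0) x} := by
    rw [cubeFam_false_of_le L a M ρ (Nat.zero_le k)]
    show cube L a M ρ k 0 = _
    simp only [cube, tlo_zero, thi_zero]
  have hgs := one_le_gs L k
  have hρ1 : 1 ≤ ρ := hL.trans hρ
  have hc : sqHi L a M ρ k 0 ∈ (cubeFam false L a M ρ k) 0 := by
    rw [hΩ0]
    intro i
    refine ⟨?_, le_rfl⟩
    simp only [sqLo, sqHi, bLo, bHi, Nat.sub_zero]
    have h1 : (1 : ℤ) ≤ (ρ : ℤ) * (gs L k : ℤ) := by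
      have : (1 : ℤ) ≤ ρ := by exact_mod_cast hρ1
      have : (1 : ℤ) ≤ gs L k := by exact_mod_cast hgs
      nlinarith
    have h2 : (0 : ℤ) ≤ (L : ℤ) ^ k * M := by positivity
    push_cast
    nlinarith
  have hmax : ∀ x ∈ (cubeFam false L a M ρ k) 0, x i₁ ≤ sqHi L a M ρ k 0 i₁ ∧ x i₂ ≤ sqHi L a M ρ k 0 i₂ := by
    intro x hx
    rw [hΩ0] at hx
    exact ⟨(hx i₁).2, (hx i₂).2⟩
  exact scalar159_clause_false_of_corner hne hL hη m (cubeFam false L a M ρ k) (cubeLamS L a M ρ k m) (cubeLamB L a M ρ k m) B₀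
    (sqHi L a M ρ k 0) hc hmax (fun j _ => cubeFam_subset_zero hL a M hρ k j)
    (fun j hj q hq x hx => cubeFam_subset_zero hL a M hρ k j (hbox_cubeLamB L a M ρ k m hm j hj q hq x hx))

#print axioms scalar159_clause_false_of_corner

end Defect

end Literature.MathematicalPhysics.QuantumFieldTheory.Balaban1983to89.B8Ineq159FlatCornerDefect

end
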